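import Literature.Barriers.QuantumFields.FiniteTemperatureReflection
import Literature.Barriers.QuantumFields.FiniteTemperatureDeconfinementInfrared
import Literature.MathematicalPhysics.QuantumFieldTheory.LatticeSiteRPMechanism
import HarnessLib

/-!
# Borgs–Seiler's diagonal bound `⟨|Tr u|²⟩ ≥ 1`: odd temporal extent

Reflection positivity in the time direction for the finite-temperature Wilson lattice gauge
theory on `ℤ_{L₀} × (ℤ/L)^d` with an ODD number `L₀ = 2m + 1` of time layers (including the
one-layer model `L₀ = 1` of Borgs–Seiler §III.1), applied to the Polyakov loop at the origin:
for a continuous unitary matrix representation `ρ` (`N ≥ 1`) and `J_E ≥ 0`,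
`∫ (|tr ρ(g_{L_0})|² − 1) e^{−S} ∏dg ≥ 0`, hence `G_L(0) = ⟨|tr ρ(g_{L_0})|²⟩ ≥ 1`
(`FiniteTemperature.one_le_polyakovCorrelation_zero_odd`). This is the printed argument
"(III.18) follows from the Clebsch–Gordan decomposition `|Tr u|² = 1 + Σ cᵢχᵢ(u)` (III.25) …
and the fact that by reflection positivity `⟨χᵢ(u)⟩ ≥ 0`" (Borgs–Seiler 1983, p. 347), with
the reflection positivity supplied by the tree's abstract mechanism
`LatticeRP.integral_mul_conj_mul_exp_nonneg_of_shared` (`LatticeSiteRPMechanism.lean`).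

## The reflection

For `L₀ = 2m + 1` the time reflection `θ t = −t` (`FiniteTemperature.timeReflect`) fixes the
lattice hyperplane `t = 0` (the SHARED block `M` = spatial links of the slice `t = 0`) and the
hyperplane half-way between the slices `m` and `m + 1` (CROSSING block `C` = the time-like links
from `m` to `m + 1`); the POSITIVE block `P` consists of the spatial links of the slices
`1, …, m` and the time-like links from `t` to `t + 1` for `t < m`. After randomising the crossing
links (`mulOn C Y`, left invariance of Haar measure) the integrand takes the form required by the
abstract theorem: with `z = splice C (U, Y)`,
* the Polyakov loop splits as `ρ(g_{L_0}) = ρ(a)ᴴ ρ(b)`, `a = gfun z`, `b = gfun (θU)`,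
  `gfun U' = U'((m,0),time)⁻¹ · H₊(U')⁻¹`, `H₊` the holonomy of the first `m` time-like links
  (`timeHolonomy_timeReflect`), so `|tr ρ(g_{L_0})|² − 1 = Σ_{pq} g_{pq}(z) conj g_{pq}(θU)` by the
  unitary identity `normSq_trace_sub_one_eq_sum`;
* the Wilson weight splits as `e^{A(U)} e^{A(θU)} e^{J_M mag₀(U)} e^{J_E elec_m}`, and the crossing
  factor is `exp(Σ_I a_I(z) conj a_I(θU))` with `a_I` the (scaled) entries of
  `A(U')(x,i) = ρ(U'((m,x),time))ᴴ ρ(U'((m,x),i)) ρ(U'((m,x+eᵢ),time))` and their conjugates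
  (`J_E ≥ 0` enters through `√(J_E/2)`).
All statements here are proved; the even case and the assembly of the named fact
`BorgsSeilerPolyakovDiagonal` are in the companion file for even `L₀`.

References: C. Borgs, E. Seiler, Commun. Math. Phys. 91 (1983) 329–380, §III.1 (III.18),
(III.23)–(III.25) (p. 347), §II.2–II.3 (pp. 331–336); K. Osterwalder, E. Seiler, Ann. Phys. 110
(1978) 440, §2. [BorgsSeiler1983]
-/

noncomputable section

open MeasureTheory Filter Topology
open scoped ComplexConjugate ComplexOrder
open Literature.MathematicalPhysics.QuantumFieldTheory (haarProbability)
open Literature.MathematicalPhysics.QuantumFieldTheory.LatticeRP (splice splice_apply piMeasure)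

namespace Literature.Barriers.QuantumFields

namespace FiniteTemperature

/-! ### Arithmetic in `ℤ_{2m+1}` -/

section ZModOdd

variable {m : ℕ}

/-- `(m : ℤ_{2m+1}).val = m`. [folklore] -/
theorem val_natCast_mid (m : ℕ) : ((m : ℕ) : ZMod (2 * m + 1)).val = m :=
  ZMod.val_cast_of_lt (by omega)

/-- `2m + 1 = 0` in `ℤ_{2m+1}`, written additively. [folklore] -/
theorem mid_add_mid_add_one (m : ℕ) : ((m : ℕ) : ZMod (2 * m + 1)) + (m : ℕ) + 1 = 0 := by
  have h := ZMod.natCast_self (2 * m + 1)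
  push_cast at h
  linear_combination h

/-- `−1 − m = m` in `ℤ_{2m+1}`: the crossing links are reflected onto themselves. [folklore] -/
theorem neg_one_sub_mid (m : ℕ) : (-1 - ((m : ℕ) : ZMod (2 * m + 1))) = (m : ℕ) := by
  linear_combination (-1 : ZMod (2 * m + 1)) * mid_add_mid_add_one m

/-- `−m = m + 1` in `ℤ_{2m+1}`. [folklore] -/
theorem neg_mid (m : ℕ) : (-((m : ℕ) : ZMod (2 * m + 1))) = (m : ℕ) + 1 := by
  linear_combination (-1 : ZMod (2 * m + 1)) * mid_add_mid_add_one m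

/-- For `1 ≤ t.val`, `(−t).val = 2m + 1 − t.val`. [folklore] -/
theorem val_neg_of_pos {t : ZMod (2 * m + 1)} (ht : 1 ≤ t.val) : (-t).val = 2 * m + 1 - t.val := by
  rw [ZMod.neg_val]
  have ht0 : t ≠ 0 := by
    intro h; rw [h, ZMod.val_zero] at ht; omega
  rw [if_neg ht0]

/-- For `t.val < 2m + 1` written as `t.val ≤ 2m`: `(−1 − t).val = 2m − t.val`. [folklore] -/
theorem val_neg_one_sub (t : ZMod (2 * m + 1)) : (-1 - t).val = 2 * m - t.val := by
  have ht := ZMod.val_lt t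
  have h1 : (-1 - t : ZMod (2 * m + 1)) = ((2 * m - t.val : ℕ) : ZMod (2 * m + 1)) := by
    have h0 := mid_add_mid_add_one m
    have h2 : ((2 * m - t.val : ℕ) : ZMod (2 * m + 1)) + 1 + (t.val : ℕ) = 0 := by
      have : ((2 * m - t.val : ℕ) : ZMod (2 * m + 1)) + 1 + (t.val : ℕ) =
          ((2 * m - t.val + 1 + t.val : ℕ) : ZMod (2 * m + 1)) := by push_cast; ring
      rw [this, show 2 * m - t.val + 1 + t.val = 2 * m + 1 by omega, ZMod.natCast_self]
    rw [ZMod.natCast_zmod_val] at h2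
    linear_combination (-1 : ZMod (2 * m + 1)) * h2
  rw [h1, ZMod.val_cast_of_lt (by omega)]

end ZModOdd

/-! ### The blocks of links -/

section Blocks

variable {d m L : ℕ} [NeZero L]

variable (d m L) in
/-- The SHARED block: spatial links of the slice `t = 0` (the lattice reflection plane). [folklore] -/
def oddShared : Finset (Site d (2 * m + 1) L × Dir d) :=
  Finset.univ.filter fun e => e.2 ≠ none ∧ e.1.1 = 0

variable (d m L) in
/-- The CROSSING block: time-like links from the slice `m` to the slice `m + 1` (bisected by the
second reflection plane). [folklore] -/
def oddCross : Finset (Site d (2 * m + 1) L × Dir d) :=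
  Finset.univ.filter fun e => e.2 = none ∧ e.1.1 = (m : ℕ)

variable (d m L) in
/-- The POSITIVE block: spatial links of the slices `1, …, m` and time-like links from `t` to
`t + 1` for `t < m`. [folklore] -/
def oddPos : Finset (Site d (2 * m + 1) L × Dir d) :=
  Finset.univ.filter fun e => (e.2 ≠ none ∧ 1 ≤ e.1.1.val ∧ e.1.1.val ≤ m) ∨
    (e.2 = none ∧ e.1.1.val < m)

/-- Membership in the shared block. [folklore] -/
@[simp] theorem mem_oddShared {e : Site d (2 * m + 1) L × Dir d} :
    e ∈ oddShared d m L ↔ e.2 ≠ none ∧ e.1.1 = 0 := by simp [oddShared]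

/-- Membership in the crossing block. [folklore] -/
@[simp] theorem mem_oddCross {e : Site d (2 * m + 1) L × Dir d} :
    e ∈ oddCross d m L ↔ e.2 = none ∧ e.1.1 = (m : ℕ) := by simp [oddCross]

/-- Membership in the positive block. [folklore] -/
@[simp] theorem mem_oddPos {e : Site d (2 * m + 1) L × Dir d} :
    e ∈ oddPos d m L ↔ (e.2 ≠ none ∧ 1 ≤ e.1.1.val ∧ e.1.1.val ≤ m) ∨
      (e.2 = none ∧ e.1.1.val < m) := by simp [oddPos]

/-- The shared and positive blocks are disjoint. [folklore] -/
theorem disjoint_oddShared_oddPos : Disjoint (oddShared d m L) (oddPos d m L) := by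
  rw [Finset.disjoint_left]
  rintro ⟨⟨t, x⟩, μ⟩ hM hP
  simp only [mem_oddShared, mem_oddPos] at hM hP
  rcases hP with ⟨-, h1, -⟩ | ⟨h, -⟩
  · rw [hM.2, ZMod.val_zero] at h1; omega
  · exact hM.1 h

/-- The shared and crossing blocks are disjoint. [folklore] -/
theorem disjoint_oddShared_oddCross : Disjoint (oddShared d m L) (oddCross d m L) := by
  rw [Finset.disjoint_left]
  rintro e hM hC
  simp only [mem_oddShared, mem_oddCross] at hM hC
  exact hM.1 hC.1

/-- A time-like link at time `m` is crossing. [folklore] -/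
theorem mem_oddCross_mid (x : Fin d → ZMod L) :
    ((((m : ℕ) : ZMod (2 * m + 1)), x), none) ∈ oddCross d m L := by simp

/-- A time-like link from `t` with `t.val < m` is positive. [folklore] -/
theorem mem_oddPos_none {t : ZMod (2 * m + 1)} (ht : t.val < m) (x : Fin d → ZMod L) :
    ((t, x), none) ∈ oddPos d m L := by simp [ht]

/-- A spatial link at time `t` with `1 ≤ t.val ≤ m` is positive. [folklore] -/
theorem mem_oddPos_some {t : ZMod (2 * m + 1)} (h1 : 1 ≤ t.val) (h2 : t.val ≤ m)
    (x : Fin d → ZMod L) (i : Fin d) : ((t, x), some i) ∈ oddPos d m L := by simp [h1, h2]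

/-- A spatial link at time `0` is shared. [folklore] -/
theorem mem_oddShared_zero (x : Fin d → ZMod L) (i : Fin d) :
    (((0 : ZMod (2 * m + 1)), x), some i) ∈ oddShared d m L := by simp

/-- A spatial link at a time `t` with `t.val ≤ m` is shared or positive. [folklore] -/
theorem mem_union_of_val_le {t : ZMod (2 * m + 1)} (ht : t.val ≤ m) (x : Fin d → ZMod L)
    (i : Fin d) : ((t, x), some i) ∈ oddPos d m L ∪ oddCross d m L ∪ oddShared d m L := by
  rcases Nat.eq_zero_or_pos t.val with h0 | hpos
  · have : t = 0 := (ZMod.val_eq_zero t).1 h0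
    subst this
    exact Finset.mem_union_right _ (mem_oddShared_zero x i)
  · exact Finset.mem_union_left _ (Finset.mem_union_left _ (mem_oddPos_some hpos ht x i))

variable {G : Type*} [Group G]

/-- The reflection fixes the shared block. [folklore] -/
theorem timeReflect_apply_of_mem_oddShared (U : Config d (2 * m + 1) L G)
    {e : Site d (2 * m + 1) L × Dir d} (he : e ∈ oddShared d m L) : timeReflect U e = U e := by
  rcases e with ⟨⟨t, x⟩, _ | i⟩
  · simp at he
  · simp only [mem_oddShared] at he
    rw [he.2, timeReflect_some, neg_zero]

/-- **The dependency condition of the abstract theorem**: the `P ∪ C`-coordinates of `θU` depend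
only on the coordinates of `U` off `P` (they are coordinates in the reflected, negative half).
[folklore] -/
theorem dependsOn_timeReflect_apply {e : Site d (2 * m + 1) L × Dir d}
    (he : e ∈ oddPos d m L ∪ oddCross d m L) :
    DependsOn (fun U : Config d (2 * m + 1) L G => timeReflect U e)
      (((oddPos d m L)ᶜ : Finset _) : Set (Site d (2 * m + 1) L × Dir d)) := by
  intro U V hUV
  rcases e with ⟨⟨t, x⟩, _ | i⟩
  · -- time-like link: `θU e = U((−1−t, x), time)⁻¹`
    simp only [timeReflect_none]
    have hmem : (((-1 - t, x), none) : Site d (2 * m + 1) L × Dir d) ∈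
        ((oddPos d m L)ᶜ : Finset _) := by
      rw [Finset.mem_compl, mem_oddPos]
      rintro (⟨h, -⟩ | ⟨-, h⟩)
      · exact h rfl
      · rw [val_neg_one_sub] at h
        rcases Finset.mem_union.1 he with hP | hC
        · rw [mem_oddPos] at hP
          rcases hP with ⟨h', -⟩ | ⟨-, h'⟩
          · exact h' rfl
          · change t.val < m at h'
            omega
        · rw [mem_oddCross] at hC
          have h2 : t.val = m := by
            have := congrArg ZMod.val hC.2
            rwa [val_natCast_mid] at this
          omega
    rw [hUV _ hmem]
  · -- spatial link in `P`: `θU e = U((−t, x), i)` with `(−t).val ≥ m + 1`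
    simp only [timeReflect_some]
    have hP : 1 ≤ t.val ∧ t.val ≤ m := by
      rcases Finset.mem_union.1 he with hP | hC
      · rw [mem_oddPos] at hP
        rcases hP with ⟨-, h1, h2⟩ | ⟨h, -⟩
        · exact ⟨h1, h2⟩
        · exact (Option.some_ne_none i h).elim
      · rw [mem_oddCross] at hC
        exact (Option.some_ne_none i hC.1).elim
    have hmem : (((-t, x), some i) : Site d (2 * m + 1) L × Dir d) ∈
        ((oddPos d m L)ᶜ : Finset _) := by
      rw [Finset.mem_compl, mem_oddPos]
      rintro (⟨-, -, h2⟩ | ⟨h, -⟩)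
      · rw [val_neg_of_pos hP.1] at h2; omega
      · exact (Option.some_ne_none i h).elim
    rw [hUV _ hmem]

end Blocks

/-! ### Dependence of holonomies and slice sums on blocks of links -/

section Depends

variable {d L₀ L : ℕ} {G : Type*} [Group G] {N : ℕ}

/-- Two configurations agreeing on the links of a time-like path have the same holonomy along
it. [folklore] -/
theorem timeHolonomy_congr {U V : Config d L₀ L G} (n : ℕ) (t : ZMod L₀) (x : Fin d → ZMod L)
    (h : ∀ j : ℕ, j < n → U ((t + j, x), none) = V ((t + j, x), none)) :
    timeHolonomy U n (t, x) = timeHolonomy V n (t, x) := by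
  induction n generalizing t with
  | zero => rfl
  | succ n ih =>
      have h0 := h 0 (Nat.succ_pos n)
      simp only [Nat.cast_zero, add_zero] at h0
      calc timeHolonomy U (n + 1) (t, x) = U ((t, x), none) * timeHolonomy U n (t + 1, x) := rfl
        _ = V ((t, x), none) * timeHolonomy V n (t + 1, x) := by
            rw [h0, ih (t + 1) fun j hj => ?_]
            have := h (j + 1) (by omega)
            push_cast at this
            rwa [show t + 1 + (j : ZMod L₀) = t + (j + 1) by ring]
        _ = timeHolonomy V (n + 1) (t, x) := rfl

variable (ρ : G →* Matrix (Fin N) (Fin N) ℂ)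

/-- Two configurations agreeing on all spatial links have the same magnetic slice sums. [folklore] -/
theorem magSlice_congr [NeZero L] {U V : Config d L₀ L G} (t : ZMod L₀)
    (h : ∀ (s : Site d L₀ L) (i : Fin d), U (s, some i) = V (s, some i)) :
    magSlice ρ t U = magSlice ρ t V := by
  unfold magSlice
  refine Finset.sum_congr rfl fun x _ => Finset.sum_congr rfl fun p _ => ?_
  simp only [plaquette, Site.shift, h]

/-- Two configurations agreeing on all spatial links and on the time-like links at time `t` have
the same electric slice sum at `t`. [folklore] -/
theorem elecSlice_congr [NeZero L] {U V : Config d L₀ L G} (t : ZMod L₀)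
    (hs : ∀ (s : Site d L₀ L) (i : Fin d), U (s, some i) = V (s, some i))
    (ht : ∀ x : Fin d → ZMod L, U ((t, x), none) = V ((t, x), none)) :
    elecSlice ρ t U = elecSlice ρ t V := by
  unfold elecSlice
  refine Finset.sum_congr rfl fun x _ => Finset.sum_congr rfl fun i _ => ?_
  simp only [plaquette, Site.shift, hs, ht]

end Depends

/-! ### The observables of the odd case -/

section Odd

variable {d m L : ℕ} {G : Type*} [Group G] {N : ℕ}
variable (ρ : G →* Matrix (Fin N) (Fin N) ℂ)

/-- `gfun U = U((m,0),time)⁻¹ · H₊(U)⁻¹`, `H₊` the holonomy of the first `m` time-like links at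
the spatial origin: the group element whose images under `ρ` at `z` and at `θU` recombine to the
Polyakov loop, `ρ(g_{L_0}) = ρ(gfun z)ᴴ ρ(gfun θU)`. [folklore] -/
def gfun (U : Config d (2 * m + 1) L G) : G :=
  (U ((((m : ℕ) : ZMod (2 * m + 1)), 0), none))⁻¹ * (timeHolonomy U m (0, 0))⁻¹

/-- The coefficients `F_{pq}(a) = a_p conj(a_q) − δ_{pq}/N` of the unitary identity
`normSq_trace_sub_one_eq_sum`. [folklore] -/
def fcoef (N : ℕ) (a : Matrix (Fin N) (Fin N) ℂ) (p q : Fin N × Fin N) : ℂ :=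
  a p.1 p.2 * conj (a q.1 q.2) - if p = q then ((N : ℂ))⁻¹ else 0

/-- The positive-side part of the exponent of the Wilson weight:
`A(U) = J_E Σ_{j<m} elec_j(U) + J_M Σ_{j<m} mag_{j+1}(U)`. [folklore] -/
def posExponent [NeZero L] (JE JM : ℝ) (U : Config d (2 * m + 1) L G) : ℝ :=
  JE * ∑ j ∈ Finset.range m, elecSlice ρ (j : ZMod (2 * m + 1)) U +
    JM * ∑ j ∈ Finset.range m, magSlice ρ ((j + 1 : ℕ) : ZMod (2 * m + 1)) U

/-- The observable `g_{pq}`: `conj F_{pq}(ρ(gfun U))` times the square roots of the positive-side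
and plane Boltzmann factors. [folklore] -/
def gobs [NeZero L] (JE JM : ℝ) (p q : Fin N × Fin N) (U : Config d (2 * m + 1) L G) : ℂ :=
  conj (fcoef N (ρ (gfun U)) p q) * (Real.exp (posExponent ρ JE JM U) : ℂ) *
    (Real.exp (JM * magSlice ρ 0 U / 2) : ℂ)

/-- The matrix `A(U)(x,i) = ρ(U((m,x),time))ᴴ ρ(U((m,x),i)) ρ(U((m,x+eᵢ),time))` whose entries
carry the crossing plaquettes: after randomisation the crossing plaquette at `(x, i)` has
`Re tr ρ(U_P) = Re tr(A(z)(x,i)ᴴ A(θU)(x,i))`. [folklore] -/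
def amat (U : Config d (2 * m + 1) L G) (x : Fin d → ZMod L) (i : Fin d) :
    Matrix (Fin N) (Fin N) ℂ :=
  star (ρ (U ((((m : ℕ) : ZMod (2 * m + 1)), x), none))) *
    ρ (U ((((m : ℕ) : ZMod (2 * m + 1)), x), some i)) *
    ρ (U ((((m : ℕ) : ZMod (2 * m + 1)), x + Pi.single i 1), none))

/-- The coefficient functions `a_I` of the crossing factor `exp(Σ_I a_I(z) conj a_I(θU))`: the
entries of `A(U)(x,i)` and their conjugates, scaled by `√(J_E/2)`. [folklore] -/
def acoef (JE : ℝ) : ((Fin d → ZMod L) × Fin d × Fin N × Fin N) × Bool →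
    Config d (2 * m + 1) L G → ℂ
  | ((x, i, k, l), false) => fun U => (Real.sqrt (JE / 2) : ℂ) * amat ρ U x i k l
  | ((x, i, k, l), true) => fun U => (Real.sqrt (JE / 2) : ℂ) * conj (amat ρ U x i k l)

end Odd

/-! ### Properties of the observables: continuity, bounds, dependence on the blocks -/

section OddProps

variable {d m L : ℕ} [NeZero L] {G : Type*} [Group G] {N : ℕ}
variable (ρ : G →* Matrix (Fin N) (Fin N) ℂ)

/-- Injectivity of small natural numbers in `ℤ_{2m+1}`. [folklore] -/
theorem natCast_injective_of_lt {a b : ℕ} (ha : a < 2 * m + 1) (hb : b < 2 * m + 1)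
    (h : (a : ZMod (2 * m + 1)) = b) : a = b := by
  have := congrArg ZMod.val h
  rwa [ZMod.val_cast_of_lt ha, ZMod.val_cast_of_lt hb] at this

/-- The links of the first `m` time-like steps at the origin are not crossing. [folklore] -/
theorem zero_add_natCast_none_not_mem_oddCross {j : ℕ} (hj : j < m) (x : Fin d → ZMod L) :
    (((0 + (j : ZMod (2 * m + 1)), x), none) : Site d (2 * m + 1) L × Dir d) ∉ oddCross d m L := by
  rw [mem_oddCross, zero_add]
  rintro ⟨-, h⟩
  have := natCast_injective_of_lt (by omega) (by omega) h
  omega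

/-- The links of the first `m` time-like steps at the origin are positive. [folklore] -/
theorem zero_add_natCast_none_mem_oddPos {j : ℕ} (hj : j < m) (x : Fin d → ZMod L) :
    (((0 + (j : ZMod (2 * m + 1)), x), none) : Site d (2 * m + 1) L × Dir d) ∈ oddPos d m L := by
  rw [zero_add]
  apply mem_oddPos_none
  rw [ZMod.val_cast_of_lt (by omega)]; exact hj

/-- The links of the last `m` time-like steps at the origin are not crossing. [folklore] -/
theorem mid_add_one_add_natCast_none_not_mem_oddCross {j : ℕ} (hj : j < m) (x : Fin d → ZMod L) :
    (((((m : ℕ) : ZMod (2 * m + 1)) + 1 + (j : ZMod (2 * m + 1)), x), none) :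
      Site d (2 * m + 1) L × Dir d) ∉ oddCross d m L := by
  rw [mem_oddCross]
  rintro ⟨-, h⟩
  have h' : ((m + 1 + j : ℕ) : ZMod (2 * m + 1)) = ((m : ℕ) : ZMod (2 * m + 1)) := by
    push_cast; exact h
  have := natCast_injective_of_lt (by omega) (by omega) h'
  omega

/-- `gfun` on a spliced configuration `z = splice C (U, Y)`: `gfun z = Y(c₀)⁻¹ H₊(U)⁻¹`. [folklore] -/
theorem gfun_splice (U Y : Config d (2 * m + 1) L G) :
    gfun (splice (oddCross d m L) (U, Y)) =
      (Y ((((m : ℕ) : ZMod (2 * m + 1)), 0), none))⁻¹ * (timeHolonomy U m (0, 0))⁻¹ := by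
  unfold gfun
  congr 2
  · rw [splice_apply, if_pos (mem_oddCross_mid 0)]
  · refine timeHolonomy_congr m 0 0 fun j hj => ?_
    rw [splice_apply, if_neg (zero_add_natCast_none_not_mem_oddCross hj 0)]

omit [NeZero L] in
/-- `gfun` on the reflected configuration: `gfun (θU) = U(c₀) · H₋(U)`, `H₋` the holonomy of the
last `m` time-like links (`timeHolonomy_timeReflect`). [folklore] -/
theorem gfun_timeReflect (U : Config d (2 * m + 1) L G) :
    gfun (timeReflect U) = U ((((m : ℕ) : ZMod (2 * m + 1)), 0), none) *
      timeHolonomy U m ((((m : ℕ) : ZMod (2 * m + 1)) + 1), 0) := by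
  unfold gfun
  rw [timeReflect_none, neg_one_sub_mid, inv_inv, timeHolonomy_timeReflect, inv_inv, neg_zero,
    zero_sub, neg_mid]

omit [NeZero L] in
/-- The Polyakov loop at the origin as first half · middle link · second half. [folklore] -/
theorem polyakovLine_zero_eq_odd (V : Config d (2 * m + 1) L G) :
    polyakovLine V 0 = timeHolonomy V m (0, 0) * (V ((((m : ℕ) : ZMod (2 * m + 1)), 0), none) *
      timeHolonomy V m ((((m : ℕ) : ZMod (2 * m + 1)) + 1), 0)) := by
  unfold polyakovLine
  have h : timeHolonomy V (2 * m + 1) ((0 : ZMod (2 * m + 1)), (0 : Fin d → ZMod L)) =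
      timeHolonomy V (m + (m + 1)) (0, 0) := by
    congr 1; ring
  rw [h, timeHolonomy_add, zero_add]
  rfl

/-- The Polyakov loop after randomising the crossing links. [folklore] -/
theorem polyakovLine_mulOn_oddCross (U Y : Config d (2 * m + 1) L G) :
    polyakovLine (mulOn (oddCross d m L) Y U) 0 = timeHolonomy U m (0, 0) *
      ((Y ((((m : ℕ) : ZMod (2 * m + 1)), 0), none) * U ((((m : ℕ) : ZMod (2 * m + 1)), 0), none)) *
        timeHolonomy U m ((((m : ℕ) : ZMod (2 * m + 1)) + 1), 0)) := by
  rw [polyakovLine_zero_eq_odd, mulOn_apply_of_mem (mem_oddCross_mid 0)]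
  congr 1
  · exact timeHolonomy_congr m 0 0 fun j hj =>
      mulOn_apply_of_not_mem (zero_add_natCast_none_not_mem_oddCross hj 0) Y U
  · congr 1
    exact timeHolonomy_congr m _ 0 fun j hj =>
      mulOn_apply_of_not_mem (mid_add_one_add_natCast_none_not_mem_oddCross hj 0) Y U

/-- **The Polyakov loop splits across the reflection**:
`ρ(g_{L_0}(mulOn C Y U)) = ρ(gfun z)ᴴ ρ(gfun θU)` with `z = splice C (U, Y)`. [folklore] -/
theorem rep_polyakovLine_mulOn (hρu : ∀ g, ρ g ∈ Matrix.unitaryGroup (Fin N) ℂ)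
    (U Y : Config d (2 * m + 1) L G) :
    ρ (polyakovLine (mulOn (oddCross d m L) Y U) 0) =
      star (ρ (gfun (splice (oddCross d m L) (U, Y)))) * ρ (gfun (timeReflect U)) := by
  rw [← rep_inv_eq_star ρ hρu, ← map_mul, polyakovLine_mulOn_oddCross, gfun_splice,
    gfun_timeReflect, mul_inv_rev, inv_inv, inv_inv]
  congr 1
  simp only [mul_assoc]

end OddProps

/-! ### The Wilson weight across the reflection -/

section OddWeight

variable {d m L : ℕ} [NeZero L] {G : Type*} [Group G] {N : ℕ}
variable (ρ : G →* Matrix (Fin N) (Fin N) ℂ)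

/-- Magnetic slice sums depend only on the spatial links of their slice. [folklore] -/
theorem magSlice_congr_slice {L₀ : ℕ} {U V : Config d L₀ L G} (t : ZMod L₀)
    (h : ∀ (x : Fin d → ZMod L) (i : Fin d), U ((t, x), some i) = V ((t, x), some i)) :
    magSlice ρ t U = magSlice ρ t V := by
  unfold magSlice
  refine Finset.sum_congr rfl fun x _ => Finset.sum_congr rfl fun p _ => ?_
  simp only [plaquette, Site.shift, h]

/-- Electric slice sums depend only on the spatial links of the two slices and the time-like
links between them. [folklore] -/
theorem elecSlice_congr_slice {L₀ : ℕ} {U V : Config d L₀ L G} (t : ZMod L₀)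
    (h0 : ∀ (x : Fin d → ZMod L) (i : Fin d), U ((t, x), some i) = V ((t, x), some i))
    (h1 : ∀ (x : Fin d → ZMod L) (i : Fin d), U ((t + 1, x), some i) = V ((t + 1, x), some i))
    (ht : ∀ x : Fin d → ZMod L, U ((t, x), none) = V ((t, x), none)) :
    elecSlice ρ t U = elecSlice ρ t V := by
  unfold elecSlice
  refine Finset.sum_congr rfl fun x _ => Finset.sum_congr rfl fun i _ => ?_
  simp only [plaquette, Site.shift, h0, h1, ht]

/-- `mulOn C Y U` and `U` agree off the crossing block, in particular on all spatial links. [folklore] -/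
theorem mulOn_oddCross_some (Y U : Config d (2 * m + 1) L G) (s : Site d (2 * m + 1) L) (i : Fin d) :
    mulOn (oddCross d m L) Y U (s, some i) = U (s, some i) :=
  mulOn_apply_of_not_mem (by simp) Y U

/-- … and on the time-like links at times `≠ m`. [folklore] -/
theorem mulOn_oddCross_none_of_ne (Y U : Config d (2 * m + 1) L G) {t : ZMod (2 * m + 1)}
    (ht : t ≠ (m : ℕ)) (x : Fin d → ZMod L) :
    mulOn (oddCross d m L) Y U ((t, x), none) = U ((t, x), none) :=
  mulOn_apply_of_not_mem (by simp [ht]) Y U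

omit [Group G] in
/-- The spliced configuration agrees with `U` on all spatial links. [folklore] -/
theorem splice_oddCross_some (U Y : Config d (2 * m + 1) L G) (s : Site d (2 * m + 1) L) (i : Fin d) :
    splice (oddCross d m L) (U, Y) (s, some i) = U (s, some i) := by
  rw [splice_apply, if_neg (by simp)]

omit [Group G] in
/-- … and on the time-like links at times `≠ m`. [folklore] -/
theorem splice_oddCross_none_of_ne (U Y : Config d (2 * m + 1) L G) {t : ZMod (2 * m + 1)}
    (ht : t ≠ (m : ℕ)) (x : Fin d → ZMod L) :
    splice (oddCross d m L) (U, Y) ((t, x), none) = U ((t, x), none) := by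
  rw [splice_apply, if_neg (by simp [ht])]

/-- `(j : ℤ_{2m+1}) ≠ m` for `j < m`. [folklore] -/
theorem natCast_ne_mid {j : ℕ} (hj : j < m) : (j : ZMod (2 * m + 1)) ≠ (m : ℕ) := fun h => by
  have := natCast_injective_of_lt (by omega) (by omega) h; omega

/-- `−1 − (j : ℤ_{2m+1}) ≠ m` for `j < m`. [folklore] -/
theorem neg_one_sub_natCast_ne_mid {j : ℕ} (hj : j < m) :
    (-1 - (j : ZMod (2 * m + 1))) ≠ (m : ℕ) := fun h => by
  have h1 := congrArg ZMod.val h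
  rw [val_neg_one_sub, ZMod.val_cast_of_lt (by omega : j < 2 * m + 1), val_natCast_mid] at h1
  omega

/-- Randomising the crossing links does not change the electric slice sums at times `≠ m`. [folklore] -/
theorem elecSlice_mulOn_oddCross_of_ne (Y U : Config d (2 * m + 1) L G) {t : ZMod (2 * m + 1)}
    (ht : t ≠ (m : ℕ)) : elecSlice ρ t (mulOn (oddCross d m L) Y U) = elecSlice ρ t U :=
  elecSlice_congr_slice ρ t (fun x i => mulOn_oddCross_some Y U (t, x) i)
    (fun x i => mulOn_oddCross_some Y U (t + 1, x) i) (fun x => mulOn_oddCross_none_of_ne Y U ht x)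

/-- Randomising the crossing links does not change the magnetic slice sums. [folklore] -/
theorem magSlice_mulOn_oddCross (Y U : Config d (2 * m + 1) L G) (t : ZMod (2 * m + 1)) :
    magSlice ρ t (mulOn (oddCross d m L) Y U) = magSlice ρ t U :=
  magSlice_congr_slice ρ t fun x i => mulOn_oddCross_some Y U (t, x) i

/-- Splicing the crossing links does not change the electric slice sums at times `≠ m`. [folklore] -/
theorem elecSlice_splice_oddCross_of_ne (U Y : Config d (2 * m + 1) L G) {t : ZMod (2 * m + 1)}
    (ht : t ≠ (m : ℕ)) : elecSlice ρ t (splice (oddCross d m L) (U, Y)) = elecSlice ρ t U :=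
  elecSlice_congr_slice ρ t (fun x i => splice_oddCross_some U Y (t, x) i)
    (fun x i => splice_oddCross_some U Y (t + 1, x) i) (fun x => splice_oddCross_none_of_ne U Y ht x)

/-- Splicing the crossing links does not change the magnetic slice sums. [folklore] -/
theorem magSlice_splice_oddCross (U Y : Config d (2 * m + 1) L G) (t : ZMod (2 * m + 1)) :
    magSlice ρ t (splice (oddCross d m L) (U, Y)) = magSlice ρ t U :=
  magSlice_congr_slice ρ t fun x i => splice_oddCross_some U Y (t, x) i

/-- The positive-side exponent is not changed by randomising the crossing links. [folklore] -/
theorem posExponent_mulOn_oddCross (JE JM : ℝ) (Y U : Config d (2 * m + 1) L G) :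
    posExponent ρ JE JM (mulOn (oddCross d m L) Y U) = posExponent ρ JE JM U := by
  unfold posExponent
  rw [Finset.sum_congr rfl fun j hj => elecSlice_mulOn_oddCross_of_ne ρ Y U
      (natCast_ne_mid (Finset.mem_range.1 hj)),
    Finset.sum_congr rfl fun j _ => magSlice_mulOn_oddCross ρ Y U _]

/-- The positive-side exponent is not changed by splicing the crossing links. [folklore] -/
theorem posExponent_splice_oddCross (JE JM : ℝ) (U Y : Config d (2 * m + 1) L G) :
    posExponent ρ JE JM (splice (oddCross d m L) (U, Y)) = posExponent ρ JE JM U := by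
  unfold posExponent
  rw [Finset.sum_congr rfl fun j hj => elecSlice_splice_oddCross_of_ne ρ U Y
      (natCast_ne_mid (Finset.mem_range.1 hj)),
    Finset.sum_congr rfl fun j _ => magSlice_splice_oddCross ρ U Y _]

/-- **The Wilson weight across the reflection (odd period)**: after randomising the crossing
links, `e^{−S} = e^{A(U)} e^{A(θU)} e^{J_M mag₀(U)} e^{J_E elec_m}` for a unitary `ρ`. [folklore] -/
theorem weight_mulOn_oddCross (hρu : ∀ g, ρ g ∈ Matrix.unitaryGroup (Fin N) ℂ) (JE JM : ℝ)
    (Y U : Config d (2 * m + 1) L G) :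
    weight ρ JE JM (mulOn (oddCross d m L) Y U) =
      Real.exp (posExponent ρ JE JM U) * Real.exp (posExponent ρ JE JM (timeReflect U)) *
        Real.exp (JM * magSlice ρ 0 U) *
        Real.exp (JE * elecSlice ρ ((m : ℕ) : ZMod (2 * m + 1)) (mulOn (oddCross d m L) Y U)) := by
  set V := mulOn (oddCross d m L) Y U with hV
  rw [weight, minusAction_eq_sum_slices, sum_zmod_odd_split_elec, sum_zmod_odd_split_neg,
    ← Real.exp_add, ← Real.exp_add, ← Real.exp_add]
  congr 1
  have he : ∀ j ∈ Finset.range m, elecSlice ρ (j : ZMod (2 * m + 1)) V +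
      elecSlice ρ (-1 - (j : ZMod (2 * m + 1))) V =
        elecSlice ρ (j : ZMod (2 * m + 1)) U + elecSlice ρ (j : ZMod (2 * m + 1)) (timeReflect U) := by
    intro j hj
    have hj' := Finset.mem_range.1 hj
    rw [elecSlice_timeReflect ρ hρu, hV, elecSlice_mulOn_oddCross_of_ne ρ Y U (natCast_ne_mid hj'),
      elecSlice_mulOn_oddCross_of_ne ρ Y U (neg_one_sub_natCast_ne_mid hj')]
  have hm : ∀ j ∈ Finset.range m, magSlice ρ ((j + 1 : ℕ) : ZMod (2 * m + 1)) V +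
      magSlice ρ (-((j + 1 : ℕ) : ZMod (2 * m + 1))) V =
        magSlice ρ ((j + 1 : ℕ) : ZMod (2 * m + 1)) U +
          magSlice ρ ((j + 1 : ℕ) : ZMod (2 * m + 1)) (timeReflect U) := by
    intro j _
    rw [magSlice_timeReflect, hV, magSlice_mulOn_oddCross, magSlice_mulOn_oddCross]
  have hm0 : magSlice ρ 0 V = magSlice ρ 0 U := by rw [hV, magSlice_mulOn_oddCross]
  rw [Finset.sum_congr rfl he, Finset.sum_congr rfl hm, hm0, Finset.sum_add_distrib,
    Finset.sum_add_distrib]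
  unfold posExponent
  ring

end OddWeight

/-! ### The crossing plaquettes across the reflection -/

section OddCross

variable {d m L : ℕ} [NeZero L] {G : Type*} [Group G] {N : ℕ}
variable (ρ : G →* Matrix (Fin N) (Fin N) ℂ)

/-- `A(z)(x,i)` for `z = splice C (U, Y)`: `ρ(Y_x)ᴴ ρ(v_m(x,i)) ρ(Y_{x+eᵢ})`. [folklore] -/
theorem amat_splice (U Y : Config d (2 * m + 1) L G) (x : Fin d → ZMod L) (i : Fin d) :
    amat ρ (splice (oddCross d m L) (U, Y)) x i =
      star (ρ (Y ((((m : ℕ) : ZMod (2 * m + 1)), x), none))) *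
        ρ (U ((((m : ℕ) : ZMod (2 * m + 1)), x), some i)) *
        ρ (Y ((((m : ℕ) : ZMod (2 * m + 1)), x + Pi.single i 1), none)) := by
  unfold amat
  rw [splice_apply, if_pos (mem_oddCross_mid x), splice_oddCross_some, splice_apply,
    if_pos (mem_oddCross_mid _)]

omit [NeZero L] in
/-- `A(θU)(x,i) = ρ(w_m(x)) ρ(v_{m+1}(x,i)) ρ(w_m(x+eᵢ))ᴴ` for a unitary `ρ`. [folklore] -/
theorem amat_timeReflect (hρu : ∀ g, ρ g ∈ Matrix.unitaryGroup (Fin N) ℂ)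
    (U : Config d (2 * m + 1) L G) (x : Fin d → ZMod L) (i : Fin d) :
    amat ρ (timeReflect U) x i =
      ρ (U ((((m : ℕ) : ZMod (2 * m + 1)), x), none)) *
        ρ (U ((((m : ℕ) : ZMod (2 * m + 1)) + 1, x), some i)) *
        star (ρ (U ((((m : ℕ) : ZMod (2 * m + 1)), x + Pi.single i 1), none))) := by
  unfold amat
  rw [timeReflect_none, timeReflect_some, timeReflect_none, neg_one_sub_mid, neg_mid,
    rep_inv_eq_star ρ hρu, rep_inv_eq_star ρ hρu, star_star]

/-- **The crossing plaquettes across the reflection**: after randomising the crossing links,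
`tr ρ(U_P) = tr(A(z)(x,i)ᴴ A(θU)(x,i))` for the time-like plaquette at `(m, x)` in direction
`i`. [folklore] -/
theorem trace_rep_plaquette_mulOn (hρu : ∀ g, ρ g ∈ Matrix.unitaryGroup (Fin N) ℂ)
    (U Y : Config d (2 * m + 1) L G) (x : Fin d → ZMod L) (i : Fin d) :
    (ρ (plaquette (mulOn (oddCross d m L) Y U) ((((m : ℕ) : ZMod (2 * m + 1))), x) none (some i))).trace =
      (star (amat ρ (splice (oddCross d m L) (U, Y)) x i) * amat ρ (timeReflect U) x i).trace := by
  rw [amat_splice, amat_timeReflect ρ hρu]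
  simp only [plaquette, Site.shift, mulOn_apply_of_mem (mem_oddCross_mid _), mulOn_oddCross_some,
    map_mul, rep_inv_eq_star ρ hρu, star_mul, star_star, Matrix.mul_assoc]
  rw [Matrix.trace_mul_comm]
  simp only [Matrix.mul_assoc]
  rw [Matrix.trace_mul_comm]
  simp only [Matrix.mul_assoc]
  rw [Matrix.trace_mul_comm]
  simp only [Matrix.mul_assoc]
  rw [Matrix.trace_mul_comm]
  simp only [Matrix.mul_assoc]

/-- **The crossing factor**: for `J_E ≥ 0`,
`e^{J_E elec_m(mulOn C Y U)} = exp(Σ_I a_I(z) conj a_I(θU))`. [folklore] -/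
theorem exp_elecSlice_mid_mulOn (hρu : ∀ g, ρ g ∈ Matrix.unitaryGroup (Fin N) ℂ) {JE : ℝ}
    (hJE : 0 ≤ JE) (U Y : Config d (2 * m + 1) L G) :
    (Real.exp (JE * elecSlice ρ ((m : ℕ) : ZMod (2 * m + 1)) (mulOn (oddCross d m L) Y U)) : ℂ) =
      Complex.exp (∑ I, acoef ρ JE I (splice (oddCross d m L) (U, Y)) *
        conj (acoef ρ JE I (timeReflect U))) := by
  rw [Complex.ofReal_exp]
  congr 1
  set z := splice (oddCross d m L) (U, Y)
  have hs : ((Real.sqrt (JE / 2) : ℂ)) * (Real.sqrt (JE / 2) : ℂ) = ((JE / 2 : ℝ) : ℂ) := by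
    rw [← Complex.ofReal_mul, Real.mul_self_sqrt (by linarith)]
  -- the sum over the doubled index set
  have hI : ∑ I, acoef ρ JE I z * conj (acoef ρ JE I (timeReflect U)) =
      ∑ c : (Fin d → ZMod L) × Fin d × Fin N × Fin N,
        ((JE : ℂ) * ((conj (amat ρ z c.1 c.2.1 c.2.2.1 c.2.2.2) *
          amat ρ (timeReflect U) c.1 c.2.1 c.2.2.1 c.2.2.2).re : ℂ)) := by
    rw [Fintype.sum_prod_type]
    refine Finset.sum_congr rfl fun c _ => ?_
    rcases c with ⟨x, i, k, l⟩
    rw [Fintype.sum_bool]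
    simp only [acoef, map_mul, Complex.conj_ofReal, Complex.conj_conj]
    set w : ℂ := conj (amat ρ z x i k l) * amat ρ (timeReflect U) x i k l with hw
    have hre : ((w.re : ℝ) : ℂ) * 2 = w + conj w := by
      rw [Complex.add_conj]; push_cast; ring
    calc (Real.sqrt (JE / 2) : ℂ) * conj (amat ρ z x i k l) *
          ((Real.sqrt (JE / 2) : ℂ) * amat ρ (timeReflect U) x i k l) +
          (Real.sqrt (JE / 2) : ℂ) * amat ρ z x i k l *
            ((Real.sqrt (JE / 2) : ℂ) * conj (amat ρ (timeReflect U) x i k l))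
        = ((Real.sqrt (JE / 2) : ℂ) * (Real.sqrt (JE / 2) : ℂ)) * (w + conj w) := by
          rw [hw, map_mul, Complex.conj_conj]; ring
      _ = (JE : ℂ) * (w.re : ℂ) := by rw [hs, ← hre]; push_cast; ring
  rw [hI, ← Finset.mul_sum, Complex.ofReal_mul]
  congr 1
  rw [elecSlice, Complex.ofReal_sum, Fintype.sum_prod_type]
  refine Finset.sum_congr rfl fun x _ => ?_
  rw [Complex.ofReal_sum, Fintype.sum_prod_type]
  refine Finset.sum_congr rfl fun i _ => ?_
  rw [trace_rep_plaquette_mulOn ρ hρu, trace_star_mul_eq_sum, Complex.re_sum, Complex.ofReal_sum,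
    Fintype.sum_prod_type]
  refine Finset.sum_congr rfl fun k _ => ?_
  rw [Complex.re_sum, Complex.ofReal_sum]

end OddCross

/-! ### The observables: continuity, bounds and dependence on `P ∪ C ∪ M` -/

section OddObservables

variable {d m L : ℕ} [NeZero L] {G : Type*} [Group G] {N : ℕ}
variable (ρ : G →* Matrix (Fin N) (Fin N) ℂ)

/-- A spatial link at a small natural-number time is shared or positive. [folklore] -/
theorem natCast_some_mem_union {j : ℕ} (hj : j ≤ m) (x : Fin d → ZMod L) (i : Fin d) :
    ((((j : ℕ) : ZMod (2 * m + 1)), x), some i) ∈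
      oddPos d m L ∪ oddCross d m L ∪ oddShared d m L :=
  mem_union_of_val_le (by rw [ZMod.val_cast_of_lt (by omega)]; exact hj) x i

/-- The same with the time written `j + 1`. [folklore] -/
theorem natCast_add_one_some_mem_union {j : ℕ} (hj : j + 1 ≤ m) (x : Fin d → ZMod L) (i : Fin d) :
    ((((j : ℕ) : ZMod (2 * m + 1)) + 1, x), some i) ∈
      oddPos d m L ∪ oddCross d m L ∪ oddShared d m L := by
  have h := natCast_some_mem_union (d := d) (L := L) hj x i
  push_cast at h
  exact h

/-- A time-like link from a small natural-number time `j < m` is positive. [folklore] -/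
theorem natCast_none_mem_union {j : ℕ} (hj : j < m) (x : Fin d → ZMod L) :
    ((((j : ℕ) : ZMod (2 * m + 1)), x), none) ∈ oddPos d m L ∪ oddCross d m L ∪ oddShared d m L :=
  Finset.mem_union_left _ (Finset.mem_union_left _
    (mem_oddPos_none (by rw [ZMod.val_cast_of_lt (by omega)]; exact hj) x))

/-- A crossing link lies in `P ∪ C ∪ M`. [folklore] -/
theorem mid_none_mem_union (x : Fin d → ZMod L) :
    ((((m : ℕ) : ZMod (2 * m + 1)), x), none) ∈ oddPos d m L ∪ oddCross d m L ∪ oddShared d m L :=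
  Finset.mem_union_left _ (Finset.mem_union_right _ (mem_oddCross_mid x))

/-- `gfun` depends only on `P ∪ C ∪ M`. [folklore] -/
theorem dependsOn_gfun : DependsOn (fun U : Config d (2 * m + 1) L G => gfun U)
    ((oddPos d m L ∪ oddCross d m L ∪ oddShared d m L : Finset _) : Set _) := by
  intro U V hUV
  simp only [gfun]
  rw [hUV _ (Finset.mem_coe.2 (mid_none_mem_union 0)),
    timeHolonomy_congr (V := V) m 0 0 fun j hj => hUV _ (Finset.mem_coe.2 ?_)]
  rw [zero_add]
  exact natCast_none_mem_union hj 0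

/-- The positive-side exponent depends only on `P ∪ C ∪ M`. [folklore] -/
theorem dependsOn_posExponent (JE JM : ℝ) :
    DependsOn (fun U : Config d (2 * m + 1) L G => posExponent ρ JE JM U)
      ((oddPos d m L ∪ oddCross d m L ∪ oddShared d m L : Finset _) : Set _) := by
  intro U V hUV
  simp only [posExponent]
  rw [Finset.sum_congr rfl fun (j : ℕ) hj => elecSlice_congr_slice ρ (U := U) (V := V) (j : ZMod (2 * m + 1))
      (fun x i => hUV _ (Finset.mem_coe.2
        (natCast_some_mem_union (Nat.le_of_lt (Finset.mem_range.1 hj)) x i)))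
      (fun x i => hUV _ (Finset.mem_coe.2
        (natCast_add_one_some_mem_union (Finset.mem_range.1 hj) x i)))
      (fun x => hUV _ (Finset.mem_coe.2 (natCast_none_mem_union (Finset.mem_range.1 hj) x))),
    Finset.sum_congr rfl fun (j : ℕ) hj => magSlice_congr_slice ρ (U := U) (V := V) _
      (fun x i => hUV _ (Finset.mem_coe.2
        (natCast_some_mem_union (Finset.mem_range.1 hj) x i)))]

/-- The plane factor depends only on the shared block. [folklore] -/
theorem dependsOn_magSlice_zero :
    DependsOn (fun U : Config d (2 * m + 1) L G => magSlice ρ 0 U)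
      ((oddPos d m L ∪ oddCross d m L ∪ oddShared d m L : Finset _) : Set _) := fun _ _ hUV =>
  magSlice_congr_slice ρ _ fun x i => hUV _ (Finset.mem_coe.2
    (Finset.mem_union_right _ (mem_oddShared_zero x i)))

/-- The observables `g_{pq}` depend only on `P ∪ C ∪ M`. [folklore] -/
theorem dependsOn_gobs (JE JM : ℝ) (p q : Fin N × Fin N) :
    DependsOn (gobs ρ JE JM p q : Config d (2 * m + 1) L G → ℂ)
      ((oddPos d m L ∪ oddCross d m L ∪ oddShared d m L : Finset _) : Set _) := by
  intro U V hUV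
  have h1 : gfun U = gfun V := dependsOn_gfun hUV
  have h2 : posExponent ρ JE JM U = posExponent ρ JE JM V := dependsOn_posExponent ρ JE JM hUV
  have h3 : magSlice ρ 0 U = magSlice ρ 0 V := dependsOn_magSlice_zero ρ hUV
  simp only [gobs]
  rw [h1, h2, h3]

/-- The matrices `A(U)(x,i)` depend only on `P ∪ C ∪ M`. [folklore] -/
theorem dependsOn_amat (x : Fin d → ZMod L) (i : Fin d) :
    DependsOn (fun U : Config d (2 * m + 1) L G => amat ρ U x i)
      ((oddPos d m L ∪ oddCross d m L ∪ oddShared d m L : Finset _) : Set _) := by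
  intro U V hUV
  simp only [amat]
  rw [hUV _ (Finset.mem_coe.2 (mid_none_mem_union x)),
    hUV _ (Finset.mem_coe.2 (natCast_some_mem_union le_rfl x i)),
    hUV _ (Finset.mem_coe.2 (mid_none_mem_union _))]

/-- The coefficients `a_I` depend only on `P ∪ C ∪ M`. [folklore] -/
theorem dependsOn_acoef (JE : ℝ) (I : ((Fin d → ZMod L) × Fin d × Fin N × Fin N) × Bool) :
    DependsOn (acoef ρ JE I : Config d (2 * m + 1) L G → ℂ)
      ((oddPos d m L ∪ oddCross d m L ∪ oddShared d m L : Finset _) : Set _) := by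
  intro U V hUV
  rcases I with ⟨⟨x, i, k, l⟩, _ | _⟩
  · have h : amat ρ U x i = amat ρ V x i := dependsOn_amat ρ x i hUV
    simp only [acoef]
    rw [h]
  · have h : amat ρ U x i = amat ρ V x i := dependsOn_amat ρ x i hUV
    simp only [acoef]
    rw [h]

omit [NeZero L] in
/-- `A(U)(x,i)` is unitary. [folklore] -/
theorem amat_mem_unitaryGroup (hρu : ∀ g, ρ g ∈ Matrix.unitaryGroup (Fin N) ℂ)
    (U : Config d (2 * m + 1) L G) (x : Fin d → ZMod L) (i : Fin d) :
    amat ρ U x i ∈ Matrix.unitaryGroup (Fin N) ℂ :=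
  Submonoid.mul_mem _ (Submonoid.mul_mem _ (Unitary.star_mem (hρu _)) (hρu _)) (hρu _)

omit [NeZero L] in
/-- `|a_I| ≤ √(J_E/2)` for a unitary `ρ`. [folklore] -/
theorem norm_acoef_le (hρu : ∀ g, ρ g ∈ Matrix.unitaryGroup (Fin N) ℂ) (JE : ℝ)
    (I : ((Fin d → ZMod L) × Fin d × Fin N × Fin N) × Bool) (U : Config d (2 * m + 1) L G) :
    ‖acoef ρ JE I U‖ ≤ Real.sqrt (JE / 2) := by
  have hs : ‖(Real.sqrt (JE / 2) : ℂ)‖ = Real.sqrt (JE / 2) := by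
    rw [Complex.norm_real, Real.norm_of_nonneg (Real.sqrt_nonneg _)]
  rcases I with ⟨⟨x, i, k, l⟩, _ | _⟩
  · simp only [acoef, norm_mul, hs]
    exact mul_le_of_le_one_right (Real.sqrt_nonneg _)
      (entry_norm_bound_of_unitary (amat_mem_unitaryGroup ρ hρu U x i) k l)
  · simp only [acoef, norm_mul, hs, Complex.norm_conj]
    exact mul_le_of_le_one_right (Real.sqrt_nonneg _)
      (entry_norm_bound_of_unitary (amat_mem_unitaryGroup ρ hρu U x i) k l)

/-- `|F_{pq}(a)| ≤ 2` for a unitary `a`. [folklore] -/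
theorem norm_fcoef_le {a : Matrix (Fin N) (Fin N) ℂ} (ha : a ∈ Matrix.unitaryGroup (Fin N) ℂ)
    (p q : Fin N × Fin N) : ‖fcoef N a p q‖ ≤ 2 := by
  unfold fcoef
  refine (norm_sub_le _ _).trans ?_
  have h1 : ‖a p.1 p.2 * conj (a q.1 q.2)‖ ≤ 1 := by
    rw [norm_mul, Complex.norm_conj]
    exact mul_le_one₀ (entry_norm_bound_of_unitary ha _ _) (norm_nonneg _)
      (entry_norm_bound_of_unitary ha _ _)
  have h2 : ‖(if p = q then ((N : ℂ))⁻¹ else 0 : ℂ)‖ ≤ 1 := by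
    split_ifs
    · rw [norm_inv, Complex.norm_natCast]
      rcases Nat.eq_zero_or_pos N with h | h
      · simp [h]
      · exact inv_le_one_of_one_le₀ (by exact_mod_cast h)
    · simp
  linarith

variable [TopologicalSpace G] [IsTopologicalGroup G]

omit [NeZero L] in
/-- Continuity of `gfun`. [folklore] -/
theorem continuous_gfun : Continuous fun U : Config d (2 * m + 1) L G => gfun U :=
  (continuous_apply _).inv.mul (continuous_timeHolonomy m _).inv

/-- Continuity of the magnetic slice sums. [folklore] -/
theorem continuous_magSlice {L₀ : ℕ} (hρ : Continuous ρ) (t : ZMod L₀) :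
    Continuous fun U : Config d L₀ L G => magSlice ρ t U :=
  continuous_finsetSum _ fun _ _ => continuous_finsetSum _ fun _ _ =>
    Complex.continuous_re.comp (Continuous.matrix_trace (hρ.comp (continuous_plaquette _ _ _)))

/-- Continuity of the electric slice sums. [folklore] -/
theorem continuous_elecSlice {L₀ : ℕ} (hρ : Continuous ρ) (t : ZMod L₀) :
    Continuous fun U : Config d L₀ L G => elecSlice ρ t U :=
  continuous_finsetSum _ fun _ _ => continuous_finsetSum _ fun _ _ =>
    Complex.continuous_re.comp (Continuous.matrix_trace (hρ.comp (continuous_plaquette _ _ _)))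

/-- Continuity of the positive-side exponent. [folklore] -/
theorem continuous_posExponent (hρ : Continuous ρ) (JE JM : ℝ) :
    Continuous fun U : Config d (2 * m + 1) L G => posExponent ρ JE JM U :=
  (continuous_const.mul (continuous_finsetSum _ fun _ _ => continuous_elecSlice ρ hρ _)).add
    (continuous_const.mul (continuous_finsetSum _ fun _ _ => continuous_magSlice ρ hρ _))

/-- Continuity of the observables `g_{pq}`. [folklore] -/
theorem continuous_gobs (hρ : Continuous ρ) (JE JM : ℝ) (p q : Fin N × Fin N) :
    Continuous (gobs ρ JE JM p q : Config d (2 * m + 1) L G → ℂ) := by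
  unfold gobs fcoef
  refine ((Complex.continuous_conj.comp ?_).mul
    (Complex.continuous_ofReal.comp (Real.continuous_exp.comp (continuous_posExponent ρ hρ JE JM)))).mul
    (Complex.continuous_ofReal.comp (Real.continuous_exp.comp
      ((continuous_const.mul (continuous_magSlice ρ hρ 0)).div_const _)))
  have hg : Continuous fun U : Config d (2 * m + 1) L G => ρ (gfun U) := hρ.comp continuous_gfun
  exact ((hg.matrix_elem p.1 p.2).mul
    (Complex.continuous_conj.comp (hg.matrix_elem q.1 q.2))).sub continuous_const

omit [NeZero L] [IsTopologicalGroup G] in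
/-- Continuity of the matrices `A(U)(x,i)`. [folklore] -/
theorem continuous_amat (hρ : Continuous ρ) (x : Fin d → ZMod L) (i : Fin d) :
    Continuous fun U : Config d (2 * m + 1) L G => amat ρ U x i :=
  (((hρ.comp (continuous_apply _)).star).mul (hρ.comp (continuous_apply _))).mul
    (hρ.comp (continuous_apply _))

omit [NeZero L] [IsTopologicalGroup G] in
/-- Continuity of the coefficients `a_I`. [folklore] -/
theorem continuous_acoef (hρ : Continuous ρ) (JE : ℝ)
    (I : ((Fin d → ZMod L) × Fin d × Fin N × Fin N) × Bool) :
    Continuous (acoef ρ JE I : Config d (2 * m + 1) L G → ℂ) := by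
  rcases I with ⟨⟨x, i, k, l⟩, _ | _⟩
  · exact continuous_const.mul ((continuous_amat ρ hρ x i).matrix_elem k l)
  · exact continuous_const.mul (Complex.continuous_conj.comp ((continuous_amat ρ hρ x i).matrix_elem k l))

variable [CompactSpace G]

omit [NeZero L] [Group G] [IsTopologicalGroup G] in
/-- Continuous functions on the (compact) configuration space are bounded. [folklore] -/
theorem exists_forall_norm_le_of_continuous {L₀ : ℕ} {E : Type*} [SeminormedAddCommGroup E]
    {f : Config d L₀ L G → E} (hf : Continuous f) : ∃ K : ℝ, ∀ U, ‖f U‖ ≤ K := by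
  obtain ⟨K, hK⟩ := isCompact_univ.exists_bound_of_continuousOn hf.continuousOn
  exact ⟨K, fun U => hK U (Set.mem_univ U)⟩

/-- The observables `g_{pq}` are uniformly bounded (unitary continuous `ρ`). [folklore] -/
theorem exists_forall_norm_gobs_le (hρu : ∀ g, ρ g ∈ Matrix.unitaryGroup (Fin N) ℂ)
    (hρ : Continuous ρ) (JE JM : ℝ) :
    ∃ K : ℝ, ∀ (p q : Fin N × Fin N) (U : Config d (2 * m + 1) L G), ‖gobs ρ JE JM p q U‖ ≤ K := by
  obtain ⟨K₁, hK₁⟩ := exists_forall_norm_le_of_continuous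
    (continuous_posExponent (d := d) (m := m) (L := L) ρ hρ JE JM)
  obtain ⟨K₂, hK₂⟩ := exists_forall_norm_le_of_continuous
    ((continuous_const.mul (continuous_magSlice (d := d) (L := L) (L₀ := 2 * m + 1) ρ hρ 0)).div_const
      (2 : ℝ) : Continuous fun U : Config d (2 * m + 1) L G => JM * magSlice ρ 0 U / 2)
  refine ⟨2 * Real.exp K₁ * Real.exp K₂, fun p q U => ?_⟩
  unfold gobs
  rw [norm_mul, norm_mul, Complex.norm_conj, Complex.norm_real, Complex.norm_real,
    Real.norm_of_nonneg (Real.exp_pos _).le, Real.norm_of_nonneg (Real.exp_pos _).le]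
  have h1 := norm_fcoef_le (hρu (gfun U)) p q
  have h2 : Real.exp (posExponent ρ JE JM U) ≤ Real.exp K₁ :=
    Real.exp_le_exp.2 ((Real.le_norm_self _).trans (hK₁ U))
  have h3 : Real.exp (JM * magSlice ρ 0 U / 2) ≤ Real.exp K₂ :=
    Real.exp_le_exp.2 ((Real.le_norm_self _).trans (hK₂ U))
  exact mul_le_mul (mul_le_mul h1 h2 (Real.exp_pos _).le (by norm_num)) h3 (Real.exp_pos _).le
    (by positivity)

end OddObservables

/-! ### Reflection positivity of the Polyakov-loop sector: the odd case -/

section OddMain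

variable {d m L : ℕ} [NeZero L] {G : Type*} [Group G] [TopologicalSpace G] [IsTopologicalGroup G]
  [CompactSpace G] [MeasurableSpace G] [BorelSpace G] [SecondCountableTopology G] {N : ℕ}
variable (ρ : G →* Matrix (Fin N) (Fin N) ℂ)

omit [NeZero L] [CompactSpace G] [MeasurableSpace G] [BorelSpace G] [SecondCountableTopology G]
  [Group G] [IsTopologicalGroup G] in
/-- The splice map is continuous. [folklore] -/
theorem continuous_splice' (C : Finset (Site d (2 * m + 1) L × Dir d)) :
    Continuous (splice C : Config d (2 * m + 1) L G × Config d (2 * m + 1) L G → Config d (2 * m + 1) L G) := by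
  refine continuous_pi fun e => ?_
  by_cases he : e ∈ C
  · have : (fun p : Config d (2 * m + 1) L G × Config d (2 * m + 1) L G => splice C p e) =
        fun p => p.2 e := by funext p; rw [splice_apply, if_pos he]
    rw [this]; exact (continuous_apply e).comp continuous_snd
  · have : (fun p : Config d (2 * m + 1) L G × Config d (2 * m + 1) L G => splice C p e) =
        fun p => p.1 e := by funext p; rw [splice_apply, if_neg he]
    rw [this]; exact (continuous_apply e).comp continuous_fst

omit [NeZero L] [CompactSpace G] [MeasurableSpace G] [BorelSpace G] [SecondCountableTopology G] in
/-- The time reflection is continuous. [folklore] -/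
theorem continuous_timeReflect {L₀ : ℕ} :
    Continuous (timeReflect : Config d L₀ L G → Config d L₀ L G) := by
  refine continuous_pi fun e => ?_
  rcases e with ⟨⟨t, x⟩, _ | i⟩
  · simp only [timeReflect_none]; exact (continuous_apply _).inv
  · simp only [timeReflect_some]; exact continuous_apply _

omit [TopologicalSpace G] [IsTopologicalGroup G] [CompactSpace G] [MeasurableSpace G] [BorelSpace G]
  [SecondCountableTopology G] in
/-- **The integrand after randomisation is in reflection-positive form.** With
`z = splice C (U, Y)`,
`(|tr ρ(g_{L_0})|² − 1) e^{−S}` at `mulOn C Y U` equals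
`Σ_{pq} g_{pq}(z) conj g_{pq}(θU) · exp(Σ_I a_I(z) conj a_I(θU))`. [folklore] -/
theorem integrand_mulOn_eq (hρu : ∀ g, ρ g ∈ Matrix.unitaryGroup (Fin N) ℂ) (hN : N ≠ 0)
    {JE : ℝ} (hJE : 0 ≤ JE) (JM : ℝ) (U Y : Config d (2 * m + 1) L G) :
    (((‖(ρ (polyakovLine (mulOn (oddCross d m L) Y U) 0)).trace‖ ^ 2 : ℝ) : ℂ) - 1) *
        (weight ρ JE JM (mulOn (oddCross d m L) Y U) : ℂ) =
      ∑ p : Fin N × Fin N, ∑ q : Fin N × Fin N,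
        gobs ρ JE JM p q (splice (oddCross d m L) (U, Y)) *
          conj (gobs ρ JE JM p q (timeReflect U)) *
          Complex.exp (∑ I, acoef ρ JE I (splice (oddCross d m L) (U, Y)) *
            conj (acoef ρ JE I (timeReflect U))) := by
  rw [rep_polyakovLine_mulOn ρ hρu U Y,
    normSq_trace_sub_one_eq_sum (hρu (gfun (splice (oddCross d m L) (U, Y))))
      (hρu (gfun (timeReflect U))) hN,
    weight_mulOn_oddCross ρ hρu, Complex.ofReal_mul, Complex.ofReal_mul, Complex.ofReal_mul,
    exp_elecSlice_mid_mulOn ρ hρu hJE]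
  have hM : (Real.exp (JM * magSlice ρ 0 U) : ℂ) =
      (Real.exp (JM * magSlice ρ 0 U / 2) : ℂ) * (Real.exp (JM * magSlice ρ 0 U / 2) : ℂ) := by
    rw [← Complex.ofReal_mul, ← Real.exp_add, add_halves]
  rw [hM, Finset.sum_mul]
  refine Finset.sum_congr rfl fun p _ => ?_
  rw [Finset.sum_mul]
  refine Finset.sum_congr rfl fun q _ => ?_
  simp only [gobs, fcoef, map_mul, Complex.conj_ofReal, Complex.conj_conj,
    posExponent_splice_oddCross, magSlice_splice_oddCross, magSlice_timeReflect, neg_zero]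
  ring

/-- **Reflection positivity for the Polyakov-loop observable, odd period** (`L₀ = 2m + 1`,
unitary continuous `ρ`, `N ≥ 1`, `J_E ≥ 0`):
`0 ≤ ∫ (|tr ρ(g_{L_0})|² − 1) e^{−S} ∏dg` as a complex number — the positivity of the
partition function with an external charge in the (reducible) representation with character
`|tr|² − 1` ("by reflection positivity `⟨χᵢ(u)⟩ ≥ 0`"). [cite: BorgsSeiler1983, §III.1 (III.25) (p. 347)] -/
theorem integral_obs_mul_weight_nonneg_odd (hρu : ∀ g, ρ g ∈ Matrix.unitaryGroup (Fin N) ℂ)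
    (hρ : Continuous ρ) (hN : N ≠ 0) {JE : ℝ} (hJE : 0 ≤ JE) (JM : ℝ) :
    0 ≤ ∫ U, ((((‖(ρ (polyakovLine U 0)).trace‖ ^ 2 : ℝ) : ℂ) - 1) * (weight ρ JE JM U : ℂ))
      ∂haar d (2 * m + 1) L G := by
  -- the integrand is continuous, hence bounded and measurable
  have hFc : Continuous fun U : Config d (2 * m + 1) L G =>
      ((((‖(ρ (polyakovLine U 0)).trace‖ ^ 2 : ℝ) : ℂ) - 1) * (weight ρ JE JM U : ℂ)) := by
    refine ((Complex.continuous_ofReal.comp ?_).sub continuous_const).mul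
      (Complex.continuous_ofReal.comp (continuous_weight ρ hρ JE JM))
    exact ((continuous_polyakovTrace ρ hρ 0).norm).pow 2
  obtain ⟨K, hK⟩ := exists_forall_norm_le_of_continuous hFc
  rw [integral_eq_integral_prod_mulOn (oddCross d m L) hFc.measurable hK]
  simp_rw [integrand_mulOn_eq ρ hρu hN hJE JM]
  -- each term of the double sum is reflection positive
  obtain ⟨Kg, hKg⟩ := exists_forall_norm_gobs_le (d := d) (m := m) (L := L) ρ hρu hρ JE JM
  have hterm : ∀ p q : Fin N × Fin N, 0 ≤ ∫ z : (Config d (2 * m + 1) L G × Config d (2 * m + 1) L G),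
      gobs ρ JE JM p q (splice (oddCross d m L) (z.1, z.2)) *
        conj (gobs ρ JE JM p q (timeReflect z.1)) *
        Complex.exp (∑ I, acoef ρ JE I (splice (oddCross d m L) (z.1, z.2)) *
          conj (acoef ρ JE I (timeReflect z.1))) ∂(haar d (2 * m + 1) L G).prod (haar d (2 * m + 1) L G) :=
    fun p q => Literature.MathematicalPhysics.QuantumFieldTheory.LatticeRP.integral_mul_conj_mul_exp_nonneg_of_shared
      (haarProbability G) (oddShared d m L) (oddPos d m L) (oddCross d m L) timeReflect
      measurePreserving_timeReflect (fun U e he => timeReflect_apply_of_mem_oddShared U he)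
      (fun e he => dependsOn_timeReflect_apply he) disjoint_oddShared_oddPos
      disjoint_oddShared_oddCross (continuous_gobs ρ hρ JE JM p q).measurable
      (fun I => (continuous_acoef ρ hρ JE I).measurable) (fun U => hKg p q U)
      (fun I U => norm_acoef_le ρ hρu JE I U) (dependsOn_gobs ρ JE JM p q)
      (fun I => dependsOn_acoef ρ JE I)
  -- continuity of each term gives integrability, so the integral of the sum is the sum
  have hcont : ∀ p q : Fin N × Fin N, Continuous fun z : Config d (2 * m + 1) L G × Config d (2 * m + 1) L G =>
      gobs ρ JE JM p q (splice (oddCross d m L) (z.1, z.2)) *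
        conj (gobs ρ JE JM p q (timeReflect z.1)) *
        Complex.exp (∑ I, acoef ρ JE I (splice (oddCross d m L) (z.1, z.2)) *
          conj (acoef ρ JE I (timeReflect z.1))) := by
    intro p q
    have hs : Continuous fun z : Config d (2 * m + 1) L G × Config d (2 * m + 1) L G =>
        splice (oddCross d m L) (z.1, z.2) :=
      (continuous_splice' (oddCross d m L)).comp (continuous_fst.prodMk continuous_snd)
    have hθ : Continuous fun z : Config d (2 * m + 1) L G × Config d (2 * m + 1) L G =>
        timeReflect z.1 := continuous_timeReflect.comp continuous_fst
    refine (((continuous_gobs ρ hρ JE JM p q).comp hs).mul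
      (Complex.continuous_conj.comp ((continuous_gobs ρ hρ JE JM p q).comp hθ))).mul
      (Complex.continuous_exp.comp (continuous_finsetSum _ fun I _ =>
        ((continuous_acoef ρ hρ JE I).comp hs).mul
          (Complex.continuous_conj.comp ((continuous_acoef ρ hρ JE I).comp hθ))))
  have hint : ∀ p q : Fin N × Fin N, Integrable (fun z : Config d (2 * m + 1) L G × Config d (2 * m + 1) L G =>
      gobs ρ JE JM p q (splice (oddCross d m L) (z.1, z.2)) *
        conj (gobs ρ JE JM p q (timeReflect z.1)) *
        Complex.exp (∑ I, acoef ρ JE I (splice (oddCross d m L) (z.1, z.2)) *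
          conj (acoef ρ JE I (timeReflect z.1))))
      ((haar d (2 * m + 1) L G).prod (haar d (2 * m + 1) L G)) := fun p q =>
    (hcont p q).integrable_of_hasCompactSupport
      (IsCompact.of_isClosed_subset isCompact_univ (isClosed_tsupport _) (Set.subset_univ _))
  rw [integral_finsetSum _ fun p _ => integrable_finsetSum _ fun q _ => hint p q]
  refine Finset.sum_nonneg fun p _ => ?_
  rw [integral_finsetSum _ fun q _ => hint p q]
  exact Finset.sum_nonneg fun q _ => hterm p q

/-- The same as a real integral: `0 ≤ ∫ (|tr ρ(g_{L_0})|² − 1) e^{−S} ∏dg`. [cite: BorgsSeiler1983, §III.1 (III.25) (p. 347)] -/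
theorem integral_normSq_sub_one_mul_weight_nonneg_odd
    (hρu : ∀ g, ρ g ∈ Matrix.unitaryGroup (Fin N) ℂ) (hρ : Continuous ρ) (hN : N ≠ 0)
    {JE : ℝ} (hJE : 0 ≤ JE) (JM : ℝ) :
    0 ≤ ∫ U, (‖(ρ (polyakovLine U 0)).trace‖ ^ 2 - 1) * weight ρ JE JM U ∂haar d (2 * m + 1) L G := by
  have h := integral_obs_mul_weight_nonneg_odd (d := d) (m := m) (L := L) ρ hρu hρ hN hJE JM
  have hcast : ∀ U : Config d (2 * m + 1) L G,
      ((((‖(ρ (polyakovLine U 0)).trace‖ ^ 2 : ℝ) : ℂ) - 1) * (weight ρ JE JM U : ℂ)) =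
        (((‖(ρ (polyakovLine U 0)).trace‖ ^ 2 - 1) * weight ρ JE JM U : ℝ) : ℂ) := fun U => by
    push_cast; ring
  simp_rw [hcast, integral_complex_ofReal] at h
  exact Complex.zero_le_real.1 h

/-- **Borgs–Seiler's diagonal bound, odd temporal extent**: for `L₀ = 2m + 1` time layers
(including `L₀ = 1`), a continuous unitary `N × N` matrix representation `ρ` (`N ≥ 1`),
`J_E ≥ 0` and any `J_M`, the Polyakov two-point function at the origin satisfies
`G_L(0) = ⟨|tr ρ(g_{L_0})|²⟩ ≥ 1`. [cite: BorgsSeiler1983, §III.1 (III.18), (III.23)–(III.25) (p. 347)] -/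
theorem one_le_polyakovCorrelation_zero_odd (hρu : ∀ g, ρ g ∈ Matrix.unitaryGroup (Fin N) ℂ)
    (hρ : Continuous ρ) (hN : N ≠ 0) {JE : ℝ} (hJE : 0 ≤ JE) (JM : ℝ) :
    1 ≤ polyakovCorrelation (L₀ := 2 * m + 1) ρ JE JM (0 : Fin d → ZMod L) := by
  have hZ := partitionFunction_pos (d := d) (L₀ := 2 * m + 1) (L := L) ρ hρ JE JM
  have h0 := integral_normSq_sub_one_mul_weight_nonneg_odd (d := d) (m := m) (L := L) ρ hρu hρ hN hJE JM
  unfold polyakovCorrelation expectation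
  rw [le_div_iff₀ hZ, one_mul]
  have hre : ∀ U : Config d (2 * m + 1) L G,
      (polyakovTrace ρ U 0 * conj (polyakovTrace ρ U 0)).re = ‖(ρ (polyakovLine U 0)).trace‖ ^ 2 := by
    intro U
    rw [Complex.mul_conj, Complex.normSq_eq_norm_sq]
    norm_cast
  simp_rw [hre]
  have hw := integrable_of_continuous (d := d) (L₀ := 2 * m + 1) (L := L) (continuous_weight ρ hρ JE JM)
  have hf : Integrable (fun U : Config d (2 * m + 1) L G =>
      ‖(ρ (polyakovLine U 0)).trace‖ ^ 2 * weight ρ JE JM U) (haar d (2 * m + 1) L G) :=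
    integrable_of_continuous ((((continuous_polyakovTrace ρ hρ 0)).norm.pow 2).mul
      (continuous_weight ρ hρ JE JM))
  have hsub : ∫ U, (‖(ρ (polyakovLine U 0)).trace‖ ^ 2 - 1) * weight ρ JE JM U ∂haar d (2 * m + 1) L G =
      ∫ U, ‖(ρ (polyakovLine U 0)).trace‖ ^ 2 * weight ρ JE JM U ∂haar d (2 * m + 1) L G -
        ∫ U, weight ρ JE JM U ∂haar d (2 * m + 1) L G := by
    rw [← integral_sub hf hw]
    refine integral_congr_ae (ae_of_all _ fun U => ?_)
    ring
  linarith

end OddMain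

end FiniteTemperature

end Literature.Barriers.QuantumFields

end
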